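import Literature.Probability.RandomPlanarGeometry.BackwardSLEFlow
import Literature.Probability.RandomPlanarGeometry.SLEDerivativeEstimates
import HarnessLib

/-!
# Rohde–Schramm's Theorem 3.2 as a supermartingale inequality for the backward SLE flow

Trunk T-STOCH; the stochastic core of the proof of Rohde–Schramm's derivative estimate Cor. 3.5
(`Literature.Probability.RandomPlanarGeometry.RohdeSchramm2005_cor35`). Rohde–Schramm, *Basic
properties of SLE*, Ann. Math. 161 (2005), Thm. 3.2 and its proof (pp. 890–891): with
`F̂(x + iy) = (1 + x²/y²)^b y^λ`, `a = 2b + κb(1-b)/2`, `λ = 4b + κb(1-2b)/2` ((3.6), `ν = 1`) and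
`ψ = ŷ|g'|/y`, "Itô's formula gives `dM = … dB̂`. Thus `M = ψ^a F̂(z)` is a local martingale." The
source then changes time (`u = log y`) to evaluate `M` at the hitting times `T_u` exactly. We work in
the original time of the **backward** flow `hₜ(w)` (`BackwardLoewnerFlow`, `BackwardSLEFlow`; by
Lemma 3.1 this is the flow `g₋ₜ` of §3.1) and prove:

* `rsFhatSlope b v = (1 + v²)^b` — `F̂` through the slope `v = x/y` — solves
  `(κ/2) h'' - (4v/(1+v²)) h' + (2λ/(1+v²) - 4a/(1+v²)²) h = 0` (`rsFhatSlope_ode`; this is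
  "`Λ F̂ = 0`", (3.12), in slope form), whence the Itô drift of
  `Mₜ = (1 + Xₜ²/Yₜ²)^b · Φₜ`, `Φ = ψ^a (Y/im w)^λ`, vanishes (`bwdObservable_itoDrift_eq_zero`);
* **`M` stopped at `σ ≤ ρₙ` is a martingale** (`martingale_stoppedProcess_bwdSLEObs`): the Itô chain
  of `SLERSObservableIto` (product rule, Itô's formula, product rule; all integrands bounded before
  the localizing time `ρₙ = bwdLocTime κ n`), for every stopping time `σ ≤ ρₙ` of the raw Brownian
  filtration;
* **the supermartingale inequality** `E[M_{t ∧ T}] ≤ M₀ = (1 + (re w)²/(im w)²)^b` for every stopping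
  time `T` (`lintegral_stoppedProcess_bwdSLEObs_le`; optional stopping at `T ∧ ρₙ` and Fatou as
  `ρₙ ↑ ∞`), which is all that Cor. 3.5 uses of Thm. 3.2.

## References

* S. Rohde, O. Schramm, *Basic properties of SLE*, Ann. of Math. 161 (2005), (3.6), Thm. 3.2 and
  its proof ((3.10)–(3.13)), Cor. 3.5.
* D. Revuz, M. Yor, *Continuous Martingales and Brownian Motion* (1999), Ch. II (3.2), Ch. IV (3.3).
-/

noncomputable section

open Set Filter MeasureTheory Complex
open _root_.Topology
open scoped NNReal ENNReal

namespace Literature.Probability.RandomPlanarGeometry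

open Loewner Literature.Probability.Process Literature.Analysis.FunctionSpaces RohdeSchramm

/-! ### `F̂` in slope form and the equation `Λ F̂ = 0` -/

/-- Rohde–Schramm's `F̂(x + iy) = (1 + (x/y)²)^b y^λ` read through the slope: **`(1 + v²)^b`**
(real power). [cite: RohdeSchramm2005, Thm 3.2] -/
def rsFhatSlope (b : ℝ) (v : ℝ) : ℝ := (1 + v ^ 2) ^ b

/-- Unfolding of `rsFhatSlope`. [folklore] -/
theorem rsFhatSlope_apply (b v : ℝ) : rsFhatSlope b v = (1 + v ^ 2) ^ b := rfl

/-- `1 + v² > 0`. [folklore] -/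
private theorem one_add_sq_pos_aux (v : ℝ) : 0 < 1 + v ^ 2 := by positivity

/-- `(1 + v²)^b > 0`. [folklore] -/
theorem rsFhatSlope_pos (b v : ℝ) : 0 < rsFhatSlope b v := Real.rpow_pos_of_pos (one_add_sq_pos_aux v) b

/-- `(1 + v²)^b ≥ 1` for `b ≥ 0`. [folklore] -/
theorem one_le_rsFhatSlope {b : ℝ} (hb : 0 ≤ b) (v : ℝ) : 1 ≤ rsFhatSlope b v := by
  rw [rsFhatSlope_apply]
  exact Real.one_le_rpow (by nlinarith [sq_nonneg v]) hb

/-- `rsFhatSlope b` is smooth (`1 + v² ≠ 0`). [folklore] -/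
theorem contDiff_rsFhatSlope (b : ℝ) {n : WithTop ℕ∞} : ContDiff ℝ n (rsFhatSlope b) := by
  have h : ContDiff ℝ n fun v : ℝ ↦ 1 + v ^ 2 := contDiff_const.add (contDiff_id.pow 2)
  exact h.rpow_const_of_ne fun v ↦ (one_add_sq_pos_aux v).ne'

/-- `h'(v) = 2bv (1 + v²)^{b-1}`. [folklore] -/
theorem hasDerivAt_rsFhatSlope (b v : ℝ) :
    HasDerivAt (rsFhatSlope b) (2 * b * v * (1 + v ^ 2) ^ (b - 1)) v := by
  have h1 : HasDerivAt (fun v : ℝ ↦ 1 + v ^ 2) (2 * v) v := by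
    simpa using ((hasDerivAt_pow 2 v).const_add 1)
  have h2 := h1.rpow_const (p := b) (Or.inl (one_add_sq_pos_aux v).ne')
  refine h2.congr_deriv ?_
  ring

/-- `deriv h = v ↦ 2bv (1 + v²)^{b-1}`. [folklore] -/
theorem deriv_rsFhatSlope (b : ℝ) : deriv (rsFhatSlope b) = fun v ↦ 2 * b * v * (1 + v ^ 2) ^ (b - 1) :=
  funext fun v ↦ (hasDerivAt_rsFhatSlope b v).deriv

/-- `h''(v) = 2b(1 + v²)^{b-1} + 4b(b-1)v²(1 + v²)^{b-2}`. [folklore] -/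
theorem hasDerivAt_deriv_rsFhatSlope (b v : ℝ) :
    HasDerivAt (deriv (rsFhatSlope b))
      (2 * b * (1 + v ^ 2) ^ (b - 1) + 4 * b * (b - 1) * v ^ 2 * (1 + v ^ 2) ^ (b - 2)) v := by
  rw [deriv_rsFhatSlope]
  have h1 : HasDerivAt (fun v : ℝ ↦ 1 + v ^ 2) (2 * v) v := by
    simpa using ((hasDerivAt_pow 2 v).const_add 1)
  have h2 : HasDerivAt (fun v : ℝ ↦ (1 + v ^ 2) ^ (b - 1)) (2 * v * (b - 1) * (1 + v ^ 2) ^ (b - 1 - 1)) v :=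
    h1.rpow_const (p := b - 1) (Or.inl (one_add_sq_pos_aux v).ne')
  have h3 : HasDerivAt (fun v : ℝ ↦ 2 * b * v) (2 * b) v := by
    simpa using (hasDerivAt_id v).const_mul (2 * b)
  have h4 := h3.mul h2
  refine h4.congr_deriv ?_
  rw [show b - 1 - 1 = b - 2 by ring]
  ring

/-- `iteratedDeriv 2 h`. [folklore] -/
theorem iteratedDeriv_two_rsFhatSlope (b v : ℝ) :
    iteratedDeriv 2 (rsFhatSlope b) v =
      2 * b * (1 + v ^ 2) ^ (b - 1) + 4 * b * (b - 1) * v ^ 2 * (1 + v ^ 2) ^ (b - 2) := by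
  rw [iteratedDeriv_succ, iteratedDeriv_one]
  exact (hasDerivAt_deriv_rsFhatSlope b v).deriv

/-- **`Λ F̂ = 0` in slope form**: with `a = expA κ b`, `λ = expLam κ b` ((3.6), `ν = 1`),
`(κ/2) h'' - (4v/(1+v²)) h' + (2λ/(1+v²) - 4a/(1+v²)²) h = 0` for `h = (1 + v²)^b`. Rohde–Schramm
(2005), proof of Thm. 3.2 ("It is easy to verify that `F̂` satisfies `Λ F̂ = 0`", (3.12)).
[cite: RohdeSchramm2005, Thm 3.2 (proof, (3.12))] -/
theorem rsFhatSlope_ode (κ b v : ℝ) :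
    κ / 2 * iteratedDeriv 2 (rsFhatSlope b) v - 4 * v / (1 + v ^ 2) * deriv (rsFhatSlope b) v +
      (2 * expLam κ b / (1 + v ^ 2) - 4 * expA κ b / (1 + v ^ 2) ^ 2) * rsFhatSlope b v = 0 := by
  have hs := one_add_sq_pos_aux v
  set s := 1 + v ^ 2 with hsdef
  set P := s ^ (b - 2) with hP
  have h1 : s ^ (b - 1) = s * P := by
    rw [hP, show b - 1 = 1 + (b - 2) by ring, Real.rpow_add hs, Real.rpow_one]
  have h2 : s ^ b = s ^ 2 * P := by
    rw [hP, show (b : ℝ) = 2 + (b - 2) by ring, Real.rpow_add hs]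
    norm_num
  have hd1 : deriv (rsFhatSlope b) v = 2 * b * v * s ^ (b - 1) := (hasDerivAt_rsFhatSlope b v).deriv
  have hd2 : iteratedDeriv 2 (rsFhatSlope b) v = 2 * b * s ^ (b - 1) + 4 * b * (b - 1) * v ^ 2 * s ^ (b - 2) :=
    iteratedDeriv_two_rsFhatSlope b v
  have hd0 : rsFhatSlope b v = s ^ b := rfl
  rw [hd2, hd1, hd0, h1, h2, ← hP, expLam, expA]
  field_simp
  rw [hsdef]
  ring

/-! ### The Itô drift of `(1 + W²)^b Φ` vanishes -/

/-- **The Itô drift of `h(X/Y) · Φ` vanishes** given the slope equation for `h` at `v = x/y`: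
with `dX = -(2X/Q) dt - √κ dB`, `d(1/Y) = -2/(YQ) dt`, `dΦ = Φ (λ·2/Q - a·4Y²/Q²) dt`,
`dW = X d(1/Y) + (1/Y) dX`, the `dt`-coefficient of `d(h(W) Φ)`,
`h(W)·(λ·2/Q - a·4Y²/Q²)Φ + Φ[(X·(-2/(YQ)) + (1/Y)·(-2X/Q)) h'(W) + ½ (√κ/Y)² h''(W)]`, equals
`(Φ/Y²)[(κ/2)h'' - (4W/(1+W²))h' + (2λ/(1+W²) - 4a/(1+W²)²)h](W) = 0` (`Q = Y²(1+W²)`).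
[cite: RohdeSchramm2005, Thm 3.2 (proof)] -/
theorem bwdObservable_itoDrift_eq_zero (κ : ℝ≥0) {a lam x y Φ : ℝ} {h : ℝ → ℝ} (hy : y ≠ 0)
    (hode : (κ : ℝ) / 2 * iteratedDeriv 2 h (x * y⁻¹) -
      4 * (x * y⁻¹) / (1 + (x * y⁻¹) ^ 2) * deriv h (x * y⁻¹) +
      (2 * lam / (1 + (x * y⁻¹) ^ 2) - 4 * a / (1 + (x * y⁻¹) ^ 2) ^ 2) * h (x * y⁻¹) = 0) :
    h (x * y⁻¹) * ((lam * loewnerLogImRate x y - a * loewnerLogDerivRate x y) * Φ) +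
      Φ * ((x * -loewnerInvImDrift x y + y⁻¹ * -loewnerReDrift x y) * deriv h (x * y⁻¹) +
        2⁻¹ * (-Real.sqrt κ * y⁻¹) ^ 2 * iteratedDeriv 2 h (x * y⁻¹)) = 0 := by
  obtain ⟨v, rfl⟩ : ∃ v, x = v * y := ⟨x * y⁻¹, by field_simp⟩
  have hv : v * y * y⁻¹ = v := mul_inv_cancel_right₀ hy v
  rw [hv] at hode ⊢
  set h0 := h v
  set h1 := deriv h v
  set h2 := iteratedDeriv 2 h v
  have h1v : (1 + v ^ 2) ≠ 0 := by positivity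
  have hsq : (-Real.sqrt κ * y⁻¹) ^ 2 = (κ : ℝ) * y⁻¹ ^ 2 := by
    rw [mul_pow, neg_sq, Real.sq_sqrt κ.coe_nonneg]
  have key : h0 * ((lam * loewnerLogImRate (v * y) y - a * loewnerLogDerivRate (v * y) y) * Φ) +
      Φ * ((v * y * -loewnerInvImDrift (v * y) y + y⁻¹ * -loewnerReDrift (v * y) y) * h1 +
        2⁻¹ * (-Real.sqrt κ * y⁻¹) ^ 2 * h2) =
      Φ / y ^ 2 * ((κ : ℝ) / 2 * h2 - 4 * v / (1 + v ^ 2) * h1 +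
        (2 * lam / (1 + v ^ 2) - 4 * a / (1 + v ^ 2) ^ 2) * h0) := by
    rw [hsq, loewnerLogImRate_apply, loewnerLogDerivRate_apply, loewnerInvImDrift_apply, loewnerReDrift_apply]
    have hN : (v * y) ^ 2 + y ^ 2 = y ^ 2 * (1 + v ^ 2) := by ring
    rw [hN]
    field_simp
    ring
  rw [key, hode, mul_zero]

/-! ### The observable and its stopped martingale property -/

section Observable

variable (κ : ℝ≥0) (w : ℂ) (b : ℝ)

/-- Rohde–Schramm's martingale for the backward flow, normalised: **`Mₜ = (1 + Xₜ²/Yₜ²)^b Φₜ`** with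
`Φ = ψ^a (Y/im w)^λ`, `a = expA κ b`, `λ = expLam κ b`; i.e. `Mₜ = ψₜ^a F̂(Zₜ)/(im w)^λ` in the
notation of Thm. 3.2. [cite: RohdeSchramm2005, Thm 3.2] -/
def bwdSLEObs (t : ℝ≥0) (ω : ℝ≥0 → ℝ) : ℝ :=
  rsFhatSlope b (bwdSLERe κ w t ω * (bwdSLEIm κ w t ω)⁻¹) * bwdSLEWeight κ w (expA κ b) (expLam κ b) t ω

variable {κ w b}

/-- Unfolding of `bwdSLEObs`. [folklore] -/
theorem bwdSLEObs_apply (t : ℝ≥0) (ω : ℝ≥0 → ℝ) :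
    bwdSLEObs κ w b t ω = rsFhatSlope b (bwdSLERe κ w t ω * (bwdSLEIm κ w t ω)⁻¹) *
      bwdSLEWeight κ w (expA κ b) (expLam κ b) t ω := rfl

/-- `M₀ = (1 + (re w)²/(im w)²)^b`. [folklore] -/
theorem bwdSLEObs_zero (hw : 0 < w.im) (ω : ℝ≥0 → ℝ) :
    bwdSLEObs κ w b 0 ω = rsFhatSlope b (w.re * (w.im)⁻¹) := by
  rw [bwdSLEObs_apply, bwdSLERe_zero hw, bwdSLEIm_zero hw, bwdSLEWeight_zero, mul_one]

/-- `0 < M`. [folklore] -/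
theorem bwdSLEObs_pos (t : ℝ≥0) (ω : ℝ≥0 → ℝ) : 0 < bwdSLEObs κ w b t ω :=
  mul_pos (rsFhatSlope_pos _ _) (bwdSLEWeight_pos _ _ _ _)

/-- `M` in terms of the derivative: **`Mₜ = (1 + Xₜ²/Yₜ²)^b ψₜ^a (Yₜ/im w)^λ`** with
`ψₜ = (im w/Yₜ) |hₜ'(w)|`. [cite: RohdeSchramm2005, Thm 3.2] -/
theorem bwdSLEObs_eq (hw : 0 < w.im) (t : ℝ≥0) (ω : ℝ≥0 → ℝ) :
    bwdSLEObs κ w b t ω = rsFhatSlope b (bwdSLERe κ w t ω * (bwdSLEIm κ w t ω)⁻¹) *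
      ((w.im / bwdSLEIm κ w t ω * ‖deriv (fun w ↦ bwdFlow (sleDriving κ ω) w t) w‖) ^ expA κ b *
        (bwdSLEIm κ w t ω / w.im) ^ expLam κ b) := by
  rw [bwdSLEObs_apply, bwdSLEWeight_eq hw]

/-- Every path of `M` is continuous. [folklore] -/
theorem continuous_bwdSLEObs (hw : 0 < w.im) (ω : ℝ≥0 → ℝ) : Continuous fun t ↦ bwdSLEObs κ w b t ω :=
  ((contDiff_rsFhatSlope b (n := 0)).continuous.comp ((continuous_bwdSLERe hw ω).mul
    ((continuous_bwdSLEIm hw ω).inv₀ fun t ↦ (bwdSLEIm_pos hw t ω).ne'))).mul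
    (continuous_bwdSLEWeight hw _ _ ω)

/-- `M` is strongly adapted. [folklore] -/
theorem stronglyAdapted_bwdSLEObs (κ : ℝ≥0) (hw : 0 < w.im) (b : ℝ) :
    StronglyAdapted brownianFiltration (bwdSLEObs κ w b) := fun t ↦
  ((contDiff_rsFhatSlope b (n := 0)).continuous.comp_stronglyMeasurable
    ((stronglyAdapted_bwdSLERe κ hw t).mul
      (stronglyAdapted_bwdSLEIm κ hw t).measurable.inv.stronglyMeasurable)).mul
    (stronglyAdapted_bwdSLEWeight κ hw _ _ t)

/-- `M` is adapted. [folklore] -/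
theorem adapted_bwdSLEObs (κ : ℝ≥0) (hw : 0 < w.im) (b : ℝ) : Adapted brownianFiltration (bwdSLEObs κ w b) :=
  fun t ↦ (stronglyAdapted_bwdSLEObs κ hw b t).measurable

variable {n : ℕ} {σ : (ℝ≥0 → ℝ) → WithTop ℝ≥0}

/-- **Rohde–Schramm's Thm. 3.2, Itô step: `M` stopped below a localizing time is a martingale.**
Let `w ∈ ℍ`, `b ∈ ℝ`, and let `σ ≤ ρₙ = bwdLocTime κ n` be a stopping time of the raw Brownian
filtration. Then `t ↦ M_{t∧σ} = (1 + X²_{t∧σ}/Y²_{t∧σ})^b Φ_{t∧σ}` is a martingale under the pre-Wiener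
measure: `X^σ` is an Itô process (`isItoProcess_stoppedProcess_bwdSLERe`), `W = X^σ · (1/Y^σ)` by the
product rule, `h(W) = (1 + W²)^b` by Itô's formula, `h(W) Φ^σ` by the product rule again, and the drift
vanishes identically by `Λ F̂ = 0` (`rsFhatSlope_ode`, `bwdObservable_itoDrift_eq_zero`); all
integrands are bounded before `ρₙ`, so the stochastic integrals are true martingales. "Itô's formula
gives `dM_u = … dB̂`. Thus `M` is a local martingale" (p. 891), here without the time change.
[cite: RohdeSchramm2005, Thm 3.2 (proof)] -/
theorem martingale_stoppedProcess_bwdSLEObs (hw : 0 < w.im) (hσ : IsStoppingTime brownianFiltration σ)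
    (hσρ : ∀ ω, σ ω ≤ bwdLocTime κ n ω) :
    Martingale (stoppedProcess (bwdSLEObs κ w b) σ) brownianFiltration preWienerMeasure := by
  haveI := isProbabilityMeasure_preWienerMeasure'
  have hσ' : ∀ t : ℝ≥0, MeasurableSet[brownianFiltration t] {ω | σ ω < t} :=
    fun t ↦ hσ.measurableSet_lt t
  set a : ℝ := expA κ b with hadef
  set lam : ℝ := expLam κ b with hlamdef
  -- the processes
  set X : ℝ≥0 → (ℝ≥0 → ℝ) → ℝ := stoppedProcess (bwdSLERe κ w) σ with hXdef
  set Y : ℝ≥0 → (ℝ≥0 → ℝ) → ℝ := stoppedProcess (bwdSLEIm κ w) σ with hYdef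
  set A : ℝ≥0 → (ℝ≥0 → ℝ) → ℝ := fun t ω ↦ (Y t ω)⁻¹ with hAdef
  set V : ℝ≥0 → (ℝ≥0 → ℝ) → ℝ := fun t ω ↦ X t ω * A t ω with hVdef
  set Ψ : ℝ≥0 → (ℝ≥0 → ℝ) → ℝ := stoppedProcess (bwdSLEWeight κ w a lam) σ with hΨdef
  set h : ℝ → ℝ := rsFhatSlope b with hhdef
  set σB : ℝ≥0 → (ℝ≥0 → ℝ) → ℝ := trunc σ (fun _ _ ↦ -Real.sqrt κ) with hσBdef
  set bX : ℝ≥0 → (ℝ≥0 → ℝ) → ℝ := trunc σ (fun s ω ↦ -loewnerReDrift (X s ω) (Y s ω)) with hbXdef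
  set aA : ℝ≥0 → (ℝ≥0 → ℝ) → ℝ := trunc σ (fun s ω ↦ -loewnerInvImDrift (X s ω) (Y s ω)) with haAdef
  set aΨ : ℝ≥0 → (ℝ≥0 → ℝ) → ℝ := trunc σ (fun s ω ↦
    (lam * loewnerLogImRate (X s ω) (Y s ω) - a * loewnerLogDerivRate (X s ω) (Y s ω)) * Ψ s ω) with haΨdef
  set bV : ℝ≥0 → (ℝ≥0 → ℝ) → ℝ := fun t ω ↦ X t ω * aA t ω + A t ω * bX t ω with hbVdef
  set σV : ℝ≥0 → (ℝ≥0 → ℝ) → ℝ := fun t ω ↦ σB t ω * A t ω with hσVdef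
  set D1 : ℝ≥0 → (ℝ≥0 → ℝ) → ℝ := fun t ω ↦
    bV t ω * deriv h (V t ω) + 2⁻¹ * σV t ω ^ 2 * iteratedDeriv 2 h (V t ω) with hD1def
  set σG : ℝ≥0 → (ℝ≥0 → ℝ) → ℝ := fun t ω ↦ σV t ω * deriv h (V t ω) with hσGdef
  -- pathwise values and bounds
  set S : ℝ := (|w.re| + ((n : ℝ) + 1) / w.im + ((n : ℝ) + 1)) / w.im with hSdef
  have hYpos : ∀ t ω, 0 < Y t ω := fun t ω ↦ stoppedProcess_bwdSLEIm_pos hw t ω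
  have hYge : ∀ t ω, w.im ≤ Y t ω := fun t ω ↦ im_le_stoppedProcess_bwdSLEIm hw t ω
  have hXbd : ∀ t ω, |X t ω| ≤ |w.re| + ((n : ℝ) + 1) / w.im + ((n : ℝ) + 1) := fun t ω ↦
    abs_stoppedProcess_bwdSLERe_le hw hσρ t ω
  have hAbd : ∀ t ω, |A t ω| ≤ (w.im)⁻¹ := fun t ω ↦ by
    simp only [hAdef]
    rw [abs_of_pos (inv_pos.2 (hYpos t ω))]
    exact inv_anti₀ hw (hYge t ω)
  have hVS : ∀ t ω, |V t ω| ≤ S := fun t ω ↦ by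
    simp only [hVdef, hSdef]
    rw [abs_mul, div_eq_mul_inv]
    exact mul_le_mul (hXbd t ω) (hAbd t ω) (abs_nonneg _) (by positivity)
  have hS0 : 0 ≤ S := (abs_nonneg _).trans (hVS 0 fun _ ↦ 0)
  have hVmem : ∀ t ω, V t ω ∈ Icc (-S) S := fun t ω ↦ abs_le.1 (hVS t ω)
  have hσBbd : ∀ t ω, |σB t ω| ≤ Real.sqrt κ := fun t ω ↦ by
    simp only [hσBdef, trunc_apply]
    split_ifs
    · rw [abs_neg, abs_of_nonneg (Real.sqrt_nonneg _)]
    · rw [abs_zero]; exact Real.sqrt_nonneg _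
  set CΨ : ℝ := Real.exp ((2 * |lam| + 4 * |a|) / w.im ^ 2 * ((n : ℝ) + 1)) with hCΨdef
  have hΨbd : ∀ t ω, |Ψ t ω| ≤ CΨ := fun t ω ↦ abs_stoppedProcess_bwdSLEWeight_le hw hσρ a lam t ω
  have hΨpos : ∀ t ω, 0 < Ψ t ω := fun t ω ↦ stoppedProcess_bwdSLEWeight_pos a lam t ω
  -- bounds for `h, h', h''` on `[-S, S]`
  have hcont : ContDiff ℝ 2 h := contDiff_rsFhatSlope b
  have hc0 : Continuous h := hcont.continuous
  have hc1 : Continuous (deriv h) := hcont.continuous_deriv (by norm_num)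
  have hc2 : Continuous (iteratedDeriv 2 h) := hcont.continuous_iteratedDeriv 2 le_rfl
  obtain ⟨C0, hC0⟩ : ∃ C, ∀ v ∈ Icc (-S) S, |h v| ≤ C := by
    obtain ⟨C, hC⟩ := isCompact_Icc.exists_bound_of_continuousOn hc0.continuousOn
    exact ⟨C, fun v hv ↦ by simpa [Real.norm_eq_abs] using hC v hv⟩
  obtain ⟨C1, hC1⟩ : ∃ C, ∀ v ∈ Icc (-S) S, |deriv h v| ≤ C := by
    obtain ⟨C, hC⟩ := isCompact_Icc.exists_bound_of_continuousOn hc1.continuousOn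
    exact ⟨C, fun v hv ↦ by simpa [Real.norm_eq_abs] using hC v hv⟩
  have hC00 : 0 ≤ C0 := (abs_nonneg _).trans (hC0 _ (hVmem 0 fun _ ↦ 0))
  have hC10 : 0 ≤ C1 := (abs_nonneg _).trans (hC1 _ (hVmem 0 fun _ ↦ 0))
  -- path regularity
  have hXc : ∀ ω, Continuous (X · ω) := fun ω ↦ continuous_stoppedProcess_bwdSLERe hw σ ω
  have hYc : ∀ ω, Continuous (Y · ω) := fun ω ↦ continuous_stoppedProcess_bwdSLEIm hw σ ω
  have hAc : ∀ ω, Continuous (A · ω) := fun ω ↦ (hYc ω).inv₀ fun t ↦ (hYpos t ω).ne'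
  have hVc : ∀ ω, Continuous (V · ω) := fun ω ↦ (hXc ω).mul (hAc ω)
  have hΨc : ∀ ω, Continuous (Ψ · ω) := fun ω ↦ continuous_stoppedProcess_bwdSLEWeight hw a lam σ ω
  have hGc : ∀ ω, Continuous (fun t ↦ h (V t ω)) := fun ω ↦ hc0.comp (hVc ω)
  -- adaptedness and progressive measurability
  have hXa : StronglyAdapted brownianFiltration X := stronglyAdapted_stoppedProcess_bwdSLERe hw hσ
  have hYa : StronglyAdapted brownianFiltration Y := stronglyAdapted_stoppedProcess_bwdSLEIm hw hσ
  have hAa : StronglyAdapted brownianFiltration A := fun t ↦ (hYa t).measurable.inv.stronglyMeasurable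
  have hVa : StronglyAdapted brownianFiltration V := fun t ↦ (hXa t).mul (hAa t)
  have hΨa : StronglyAdapted brownianFiltration Ψ := stronglyAdapted_stoppedProcess_bwdSLEWeight hw a lam hσ
  have hGa : StronglyAdapted brownianFiltration fun t ω ↦ h (V t ω) := fun t ↦
    hc0.comp_stronglyMeasurable (hVa t)
  have hXp : IsStronglyProgressive brownianFiltration X := hXa.isStronglyProgressive_of_continuous hXc
  have hYp : IsStronglyProgressive brownianFiltration Y := hYa.isStronglyProgressive_of_continuous hYc
  have hAp : IsStronglyProgressive brownianFiltration A := hAa.isStronglyProgressive_of_continuous hAc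
  have hVp : IsStronglyProgressive brownianFiltration V := hXp.mul hAp
  have hΨp : IsStronglyProgressive brownianFiltration Ψ := hΨa.isStronglyProgressive_of_continuous hΨc
  have hGp : IsStronglyProgressive brownianFiltration fun t ω ↦ h (V t ω) :=
    IsStronglyProgressive.continuous_comp hVp hc0
  have hG1p : IsStronglyProgressive brownianFiltration fun t ω ↦ deriv h (V t ω) :=
    IsStronglyProgressive.continuous_comp hVp hc1
  have hσBp : IsStronglyProgressive brownianFiltration σB :=
    isStronglyProgressive_trunc (isStronglyProgressive_const _ _) hσ'
  have hmRe : Measurable (Function.uncurry fun x y : ℝ ↦ -loewnerReDrift x y) := measurable_loewnerReDrift.neg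
  have hmInv : Measurable (Function.uncurry fun x y : ℝ ↦ -loewnerInvImDrift x y) :=
    measurable_loewnerInvImDrift.neg
  have hbXp : IsStronglyProgressive brownianFiltration bX :=
    isStronglyProgressive_trunc (isStronglyProgressive_comp_pair hXp hYp hmRe) hσ'
  have haAp : IsStronglyProgressive brownianFiltration aA :=
    isStronglyProgressive_trunc (isStronglyProgressive_comp_pair hXp hYp hmInv) hσ'
  have hσVp : IsStronglyProgressive brownianFiltration σV := hσBp.mul hAp
  have hσGp : IsStronglyProgressive brownianFiltration σG := hσVp.mul hG1p
  have hσVbd : ∀ t ω, |σV t ω| ≤ Real.sqrt κ * (w.im)⁻¹ := fun t ω ↦ by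
    simp only [hσVdef]; rw [abs_mul]
    exact mul_le_mul (hσBbd t ω) (hAbd t ω) (abs_nonneg _) (Real.sqrt_nonneg _)
  have hσGbd : ∀ t ω, |σG t ω| ≤ Real.sqrt κ * (w.im)⁻¹ * C1 := fun t ω ↦ by
    simp only [hσGdef]; rw [abs_mul]
    exact mul_le_mul (hσVbd t ω) (hC1 _ (hVmem t ω)) (abs_nonneg _) (by positivity)
  ---------------------------------------------------------------------------
  -- Step 1: `X^σ` is an Itô process
  have hX : IsItoProcess X bX σB brownian brownianFiltration preWienerMeasure :=
    isItoProcess_stoppedProcess_bwdSLERe hw hσ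
  ---------------------------------------------------------------------------
  -- Step 2: `V = X · (1/Y)` is an Itô process (product rule)
  obtain ⟨KX, hKX, hKXM⟩ := exists_isItoIntegral_of_abs_le (hσBp.mul hXp)
    (C := Real.sqrt κ * (|w.re| + ((n : ℝ) + 1) / w.im + ((n : ℝ) + 1))) fun t ω ↦ by
      rw [abs_mul]; exact mul_le_mul (hσBbd t ω) (hXbd t ω) (abs_nonneg _) (Real.sqrt_nonneg _)
  obtain ⟨K, hK, hKM⟩ := exists_isItoIntegral_of_abs_le (hσBp.mul hAp)
    (C := Real.sqrt κ * (w.im)⁻¹) fun t ω ↦ by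
      rw [abs_mul]; exact mul_le_mul (hσBbd t ω) (hAbd t ω) (abs_nonneg _) (Real.sqrt_nonneg _)
  have hA0 : ∀ ω, A 0 ω = (w.im)⁻¹ := fun ω ↦ by
    simp only [hAdef, hYdef]; rw [stoppedProcess_bwdSLEIm_zero hw]
  have hAeq : ∀ᵐ ω ∂preWienerMeasure, ∀ t : ℝ≥0, A t ω = A 0 ω + ∫ s in (0 : ℝ)..t, aA s.toNNReal ω :=
    ae_of_all _ fun ω t ↦ by
      rw [hA0]
      exact inv_stoppedProcess_bwdSLEIm_eq_integral hw t ω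
  have haA : ∀ᵐ ω ∂preWienerMeasure, ∀ t : ℝ≥0,
      IntegrableOn (fun s : ℝ ↦ aA s.toNNReal ω) (Icc 0 t) :=
    ae_of_all _ fun ω t ↦ integrableOn_trunc_neg_loewnerInvImDrift hw ω _ isCompact_Icc
  have hV : IsItoProcess V bV σV brownian brownianFiltration preWienerMeasure :=
    IsItoProcess.mul_timeIntegral hXa hXc hσBp hX hAa hAc hAeq haA hKX hKXM hK hKM
  ---------------------------------------------------------------------------
  -- Step 3: `h(V)` is an Itô process (Itô's formula)
  obtain ⟨Kw, hKw, hKwM⟩ := exists_isItoIntegral_of_abs_le hσGp hσGbd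
  have hf' : ContDiff ℝ 2 (Function.uncurry fun (_ : ℝ) (v : ℝ) ↦ h v) := hcont.comp contDiff_snd
  have hito := ito_formula_itoProcess_ae_holds (fun (_ : ℝ) (v : ℝ) ↦ h v) hf'
    (fun t ↦ (hVa t).measurable) hσVp hV (K := Kw) (by exact hKw)
  have hGint := hV.ae_integrableOn_itoDrift hf' hσVp
  have hG : IsItoProcess (fun t ω ↦ h (V t ω)) D1 σG brownian brownianFiltration preWienerMeasure := by
    refine ⟨?_, Kw, hKw, ?_⟩
    · filter_upwards [hGint] with ω hω t
      have h1 := hω t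
      simp only [deriv_const, zero_add] at h1
      exact h1
    · filter_upwards [hito] with ω hω t
      have h1 := hω t
      simp only [deriv_const, zero_add] at h1
      exact h1
  ---------------------------------------------------------------------------
  -- Step 4: the product `h(V) Ψ` (product rule again)
  obtain ⟨KX', hKX', hKX'M⟩ := exists_isItoIntegral_of_abs_le (hσGp.mul hGp)
    (C := Real.sqrt κ * (w.im)⁻¹ * C1 * C0) fun t ω ↦ by
      rw [abs_mul]; exact mul_le_mul (hσGbd t ω) (hC0 _ (hVmem t ω)) (abs_nonneg _) (by positivity)
  obtain ⟨K', hK', hK'M⟩ := exists_isItoIntegral_of_abs_le (hσGp.mul hΨp)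
    (C := Real.sqrt κ * (w.im)⁻¹ * C1 * CΨ) fun t ω ↦ by
      rw [abs_mul]; exact mul_le_mul (hσGbd t ω) (hΨbd t ω) (abs_nonneg _) (by positivity)
  have hΨ0 : ∀ ω, Ψ 0 ω = 1 := fun ω ↦ by
    simp only [hΨdef]; rw [stoppedProcess_bwdSLEWeight_zero]
  have hΨeq : ∀ᵐ ω ∂preWienerMeasure, ∀ t : ℝ≥0, Ψ t ω = Ψ 0 ω + ∫ s in (0 : ℝ)..t, aΨ s.toNNReal ω :=
    ae_of_all _ fun ω t ↦ by
      rw [hΨ0]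
      exact stoppedProcess_bwdSLEWeight_eq_integral hw a lam t ω
  have haΨc : ∀ ω, Continuous fun r : ℝ ↦
      (lam * loewnerLogImRate (X r.toNNReal ω) (Y r.toNNReal ω) -
        a * loewnerLogDerivRate (X r.toNNReal ω) (Y r.toNNReal ω)) * Ψ r.toNNReal ω := fun ω ↦
    continuous_weightRate_stopped_mul hw a lam ω
  have haΨ : ∀ᵐ ω ∂preWienerMeasure, ∀ t : ℝ≥0,
      IntegrableOn (fun s : ℝ ↦ aΨ s.toNNReal ω) (Icc 0 t) :=
    ae_of_all _ fun ω t ↦ integrableOn_trunc ((haΨc ω).continuousOn.integrableOn_compact isCompact_Icc)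
  have hprod := ae_mul_eq_of_isItoProcess hGa hGc hσGp hG hΨa hΨc hΨeq haΨ hKX' hKX'M hK' hK'M
  ---------------------------------------------------------------------------
  -- Step 5: the drift of `h(V) Ψ` vanishes identically, by `Λ F̂ = 0`
  have hdrift : ∀ s ω, h (V s ω) * aΨ s ω + Ψ s ω * D1 s ω = 0 := by
    intro s ω
    by_cases hs : (s : WithTop ℝ≥0) ≤ σ ω
    · simp only [haΨdef, hD1def, hbVdef, hσVdef, hσBdef, hbXdef, haAdef, hVdef, hAdef, trunc_of_le hs]
      exact bwdObservable_itoDrift_eq_zero κ (hYpos s ω).ne'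
        (rsFhatSlope_ode κ b (X s ω * (Y s ω)⁻¹))
    · simp only [haΨdef, hD1def, hbVdef, hσVdef, hσBdef, hbXdef, haAdef, trunc_of_not_le hs]
      ring
  ---------------------------------------------------------------------------
  -- Step 6: `h(V) Ψ = h(V₀) + K'` a.s., hence a martingale
  have hV0 : ∀ ω, V 0 ω = w.re * (w.im)⁻¹ := fun ω ↦ by
    simp only [hVdef, hAdef, hXdef, hYdef]
    rw [stoppedProcess_bwdSLERe_zero hw, stoppedProcess_bwdSLEIm_zero hw]
  have hae : ∀ᵐ ω ∂preWienerMeasure, ∀ t : ℝ≥0,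
      h (V t ω) * Ψ t ω = h (w.re * (w.im)⁻¹) + K' t ω := by
    filter_upwards [hprod] with ω hω t
    have h1 := hω t
    simp only [hdrift, intervalIntegral.integral_zero, add_zero, hV0, hΨ0, mul_one] at h1
    exact h1
  have hMadapt : StronglyAdapted brownianFiltration fun t ω ↦ h (V t ω) * Ψ t ω := fun t ↦
    (hGa t).mul (hΨa t)
  have hmart : Martingale (fun t ω ↦ h (V t ω) * Ψ t ω) brownianFiltration preWienerMeasure := by
    have h1 : Martingale (fun t ω ↦ h (w.re * (w.im)⁻¹) + K' t ω) brownianFiltration preWienerMeasure :=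
      (martingale_const brownianFiltration preWienerMeasure (h (w.re * (w.im)⁻¹))).add hK'M
    refine h1.congr hMadapt fun t ↦ ?_
    filter_upwards [hae] with ω hω
    exact (hω t).symm
  ---------------------------------------------------------------------------
  -- Step 7: this is the stopped observable
  have heq : stoppedProcess (bwdSLEObs κ w b) σ = fun t ω ↦ h (V t ω) * Ψ t ω := by
    funext t ω
    rfl
  rw [heq]
  exact hmart

/-- **`E[M_{t∧σ}] = M₀ = (1 + (re w/im w)²)^b`** for a stopping time `σ ≤ ρₙ`. [cite: RohdeSchramm2005, Thm 3.2] -/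
theorem integral_stoppedProcess_bwdSLEObs (hw : 0 < w.im) (hσ : IsStoppingTime brownianFiltration σ)
    (hσρ : ∀ ω, σ ω ≤ bwdLocTime κ n ω) (t : ℝ≥0) :
    ∫ ω, stoppedProcess (bwdSLEObs κ w b) σ t ω ∂preWienerMeasure = rsFhatSlope b (w.re * (w.im)⁻¹) := by
  haveI := isProbabilityMeasure_preWienerMeasure'
  rw [integral_eq_of_martingale (martingale_stoppedProcess_bwdSLEObs hw hσ hσρ) t]
  have h0 : ∀ ω, stoppedProcess (bwdSLEObs κ w b) σ 0 ω = rsFhatSlope b (w.re * (w.im)⁻¹) := fun ω ↦ by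
    rw [stoppedProcess_eq_of_le (by exact_mod_cast bot_le : ((0 : ℝ≥0) : WithTop ℝ≥0) ≤ σ ω),
      bwdSLEObs_zero hw]
  simp_rw [h0]
  rw [MeasureTheory.integral_const, smul_eq_mul, probReal_univ, one_mul]

end Observable


/-! ### The supermartingale inequality `E[M_{t∧T}] ≤ M₀` -/

section Supermartingale

variable {κ : ℝ≥0} {w : ℂ} {b : ℝ}

/-- For `↑t ≤ ρ`, stopping at `T ∧ ρ` and at `T` agree at time `t`. [folklore] -/
theorem stoppedProcess_min_eq_of_le {u : ℝ≥0 → (ℝ≥0 → ℝ) → ℝ} {T ρ : (ℝ≥0 → ℝ) → WithTop ℝ≥0} {t : ℝ≥0}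
    {ω : ℝ≥0 → ℝ} (h : (t : WithTop ℝ≥0) ≤ ρ ω) :
    stoppedProcess u (fun ω ↦ min (T ω) (ρ ω)) t ω = stoppedProcess u T t ω := by
  simp only [stoppedProcess]
  congr 2
  rw [← min_assoc, min_eq_left ((min_le_left _ _).trans h)]

/-- The stopped observable at a stopping time is measurable (progressive process, `M` having
continuous adapted paths). [folklore] -/
theorem measurable_stoppedProcess_bwdSLEObs (hw : 0 < w.im) {T : (ℝ≥0 → ℝ) → WithTop ℝ≥0}
    (hT : IsStoppingTime brownianFiltration T) (t : ℝ≥0) :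
    Measurable (stoppedProcess (bwdSLEObs κ w b) T t) := by
  have hprog : IsStronglyProgressive brownianFiltration (bwdSLEObs κ w b) :=
    (stronglyAdapted_bwdSLEObs κ hw b).isStronglyProgressive_of_continuous (continuous_bwdSLEObs hw)
  have h := (hprog.stoppedProcess hT).stronglyAdapted t
  exact (h.mono (brownianFiltration.le t)).measurable

/-- **Rohde–Schramm's Thm. 3.2 as a supermartingale inequality**: for every stopping time `T` of
the raw Brownian filtration and every `t`,
`E[M_{t∧T}] ≤ M₀ = (1 + (re w/im w)²)^b` (in `ℝ≥0∞`). Optional stopping at the bounded stopping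
times `T ∧ ρₙ` (`integral_stoppedProcess_bwdSLEObs`) and Fatou's lemma as `ρₙ ↑ ∞`
(`exists_le_bwdLocTime`: `M_{t∧T∧ρₙ} = M_{t∧T}` eventually, pathwise). This replaces the exact
evaluation `E[ψ(0)^a F̂(z(0))] = F̂(ẑ)` ((3.13), via the time change `u = log y` and Lemma 2.1)
by the inequality that Cor. 3.5 actually uses. [cite: RohdeSchramm2005, Thm 3.2] -/
theorem lintegral_stoppedProcess_bwdSLEObs_le (hw : 0 < w.im) {T : (ℝ≥0 → ℝ) → WithTop ℝ≥0}
    (hT : IsStoppingTime brownianFiltration T) (t : ℝ≥0) :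
    ∫⁻ ω, ENNReal.ofReal (stoppedProcess (bwdSLEObs κ w b) T t ω) ∂preWienerMeasure ≤
      ENNReal.ofReal (rsFhatSlope b (w.re * (w.im)⁻¹)) := by
  haveI := isProbabilityMeasure_preWienerMeasure'
  set σ : ℕ → (ℝ≥0 → ℝ) → WithTop ℝ≥0 := fun n ω ↦ min (T ω) (bwdLocTime κ n ω) with hσdef
  have hσ : ∀ n, IsStoppingTime brownianFiltration (σ n) := fun n ↦ hT.min (isStoppingTime_bwdLocTime κ n)
  have hσρ : ∀ n ω, σ n ω ≤ bwdLocTime κ n ω := fun n ω ↦ min_le_right _ _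
  set f : ℕ → (ℝ≥0 → ℝ) → ℝ≥0∞ := fun n ω ↦ ENNReal.ofReal (stoppedProcess (bwdSLEObs κ w b) (σ n) t ω)
    with hfdef
  have hfmeas : ∀ n, AEMeasurable (f n) preWienerMeasure := fun n ↦
    (measurable_stoppedProcess_bwdSLEObs hw (hσ n) t).ennreal_ofReal.aemeasurable
  -- `∫⁻ fₙ = M₀`
  have hfint : ∀ n, ∫⁻ ω, f n ω ∂preWienerMeasure = ENNReal.ofReal (rsFhatSlope b (w.re * (w.im)⁻¹)) := by
    intro n
    have hmart := martingale_stoppedProcess_bwdSLEObs (b := b) hw (hσ n) (hσρ n)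
    rw [hfdef, ← ofReal_integral_eq_lintegral_ofReal (hmart.integrable t)
      (ae_of_all _ fun ω ↦ (bwdSLEObs_pos _ ω).le), integral_stoppedProcess_bwdSLEObs hw (hσ n) (hσρ n) t]
  -- `fₙ → ofReal M_{t∧T}` pointwise (eventually constant)
  have hflim : ∀ ω, Tendsto (fun n ↦ f n ω) atTop
      (𝓝 (ENNReal.ofReal (stoppedProcess (bwdSLEObs κ w b) T t ω))) := by
    intro ω
    obtain ⟨N, hN⟩ := exists_le_bwdLocTime ω t (κ := κ)
    refine tendsto_atTop_of_eventually_const (i₀ := N) fun n hn ↦ ?_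
    simp only [hfdef, hσdef]
    rw [stoppedProcess_min_eq_of_le (hN.trans (bwdLocTime_mono ω hn))]
  have hliminf : (fun ω ↦ liminf (fun n ↦ f n ω) atTop) = fun ω ↦
      ENNReal.ofReal (stoppedProcess (bwdSLEObs κ w b) T t ω) := funext fun ω ↦ (hflim ω).liminf_eq
  calc ∫⁻ ω, ENNReal.ofReal (stoppedProcess (bwdSLEObs κ w b) T t ω) ∂preWienerMeasure
      = ∫⁻ ω, liminf (fun n ↦ f n ω) atTop ∂preWienerMeasure := by rw [hliminf]
    _ ≤ liminf (fun n ↦ ∫⁻ ω, f n ω ∂preWienerMeasure) atTop := lintegral_liminf_le' hfmeas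
    _ = ENNReal.ofReal (rsFhatSlope b (w.re * (w.im)⁻¹)) := by
        simp only [hfint, liminf_const]

end Supermartingale

/-! ### Hitting a level: Chebyshev at `T_L` -/

section Hitting

variable (κ : ℝ≥0) (w : ℂ)

/-- **`T_L`**: the first time `Yₜ = im hₜ(w)` reaches the level `L` (Rohde–Schramm's `T_u`,
`u = log L`, for the backward flow, (3.8)). [cite: RohdeSchramm2005, eq. (3.8)] -/
def bwdSLEImHit (L : ℝ) : (ℝ≥0 → ℝ) → WithTop ℝ≥0 := hittingAfter (bwdSLEIm κ w) (Ici L) 0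

variable {κ w}

/-- `T_L` is a stopping time of the raw Brownian filtration (hitting of a closed set by a continuous
adapted process). [folklore] -/
theorem isStoppingTime_bwdSLEImHit (hw : 0 < w.im) (L : ℝ) :
    IsStoppingTime brownianFiltration (bwdSLEImHit κ w L) :=
  Literature.Probability.Process.isStoppingTime_hittingAfter_of_continuous (adapted_bwdSLEIm κ hw)
    (continuous_bwdSLEIm hw) isClosed_Ici

/-- **At `T_L` the level is attained exactly: `Y_{T_L} = L`** (`im w ≤ L`; continuity). [folklore] -/
theorem bwdSLEIm_eq_of_bwdSLEImHit_eq (hw : 0 < w.im) {L : ℝ} (hL : w.im ≤ L) {ω : ℝ≥0 → ℝ} {T : ℝ≥0}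
    (h : bwdSLEImHit κ w L ω = T) : bwdSLEIm κ w T ω = L := by
  have hge : L ≤ bwdSLEIm κ w T ω :=
    mem_of_hittingAfter_zero_eq_coe (u := bwdSLEIm κ w) isClosed_Ici (continuous_bwdSLEIm hw ω) h
  refine le_antisymm ?_ hge
  have hbefore : ∀ r : ℝ≥0, (r : WithTop ℝ≥0) < bwdSLEImHit κ w L ω → bwdSLEIm κ w r ω ≤ L := fun r hr ↦ by
    have := notMem_of_coe_lt_hittingAfter_zero (u := bwdSLEIm κ w) (s := Ici L) hr
    exact (not_le.1 this).le
  rcases eq_or_ne T 0 with rfl | hT0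
  · rw [bwdSLEIm_zero hw]; exact hL
  · have hpos : 0 < T := pos_iff_ne_zero.2 hT0
    have h1 := le_apply_of_forall_lt (u := fun r ↦ -bwdSLEIm κ w r ω) ((continuous_bwdSLEIm hw ω).neg)
      (c := -L) hpos fun r hr ↦ neg_le_neg (hbefore r (by rw [h]; exact_mod_cast hr))
    linarith

/-- **Chebyshev at the hitting time (the use of Thm. 3.2 in Cor. 3.5).** Let `b ≥ 0` with
`a = expA κ b ≥ 0`, `λ = expLam κ b`, `w ∈ ℍ`, `L ≥ im w`, `t ≥ 0` and `D > 0`. Then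
`P[T_L ≤ t, |h'_{T_L}(w)| ≥ D] ≤ (1 + (re w/im w)²)^b (L/(im w · D))^a (im w/L)^λ`:
on the event, `M_{t∧T_L} = (1 + X²/Y²)^b ψ^a (L/im w)^λ ≥ (im w · D/L)^a (L/im w)^λ`
(`Y_{T_L} = L`, `ψ = (im w/L)|h'|`), and `E[M_{t∧T_L}] ≤ M₀`. This is the estimate
"`P[|g'_{T_j}(z)| ≥ δ y⁻¹] ≤ δ^{-a} e^{ja} F_b(e^{-j}z)`" of the proof of Cor. 3.5 (p. 894).
[cite: RohdeSchramm2005, Cor 3.5 (proof)] -/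
theorem measure_bwdSLEImHit_le_and_le_norm_deriv_le {b : ℝ} (hb : 0 ≤ b) (ha : 0 ≤ expA κ b)
    (hw : 0 < w.im) {L : ℝ} (hL : w.im ≤ L) (t : ℝ≥0) {D : ℝ} (hD : 0 < D) :
    preWienerMeasure {ω | bwdSLEImHit κ w L ω ≤ t ∧
        ∃ T : ℝ≥0, bwdSLEImHit κ w L ω = T ∧ D ≤ ‖deriv (fun w' ↦ bwdFlow (sleDriving κ ω) w' T) w‖} ≤
      ENNReal.ofReal (rsFhatSlope b (w.re * (w.im)⁻¹) * (L / (w.im * D)) ^ expA κ b *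
        (w.im / L) ^ expLam κ b) := by
  haveI := isProbabilityMeasure_preWienerMeasure'
  have hLpos : 0 < L := hw.trans_le hL
  set a := expA κ b with hadef
  set lam := expLam κ b with hlamdef
  set c : ℝ := (w.im * D / L) ^ a * (L / w.im) ^ lam with hcdef
  have hcpos : 0 < c := mul_pos (Real.rpow_pos_of_pos (by positivity) _) (Real.rpow_pos_of_pos (by positivity) _)
  set M := stoppedProcess (bwdSLEObs κ w b) (bwdSLEImHit κ w L) t with hMdef
  have hTst := isStoppingTime_bwdSLEImHit hw L (κ := κ)
  -- on the event, `c ≤ M`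
  have hsub : {ω | bwdSLEImHit κ w L ω ≤ t ∧
      ∃ T : ℝ≥0, bwdSLEImHit κ w L ω = T ∧ D ≤ ‖deriv (fun w' ↦ bwdFlow (sleDriving κ ω) w' T) w‖} ⊆
      {ω | ENNReal.ofReal c ≤ ENNReal.ofReal (M ω)} := by
    rintro ω ⟨hle, T, hT, hDle⟩
    rw [mem_setOf_eq]
    refine ENNReal.ofReal_le_ofReal ?_
    have hclock : (min (t : WithTop ℝ≥0) (bwdSLEImHit κ w L ω)).untopA = T := by
      rw [hT] at hle ⊢
      rw [min_eq_right hle]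
      rfl
    have hYT : bwdSLEIm κ w T ω = L := bwdSLEIm_eq_of_bwdSLEImHit_eq hw hL hT
    have hMval : M ω = rsFhatSlope b (bwdSLERe κ w T ω * (bwdSLEIm κ w T ω)⁻¹) *
        ((w.im / bwdSLEIm κ w T ω * ‖deriv (fun w' ↦ bwdFlow (sleDriving κ ω) w' T) w‖) ^ a *
          (bwdSLEIm κ w T ω / w.im) ^ lam) := by
      rw [hMdef, stoppedProcess, hclock, bwdSLEObs_eq hw]
    rw [hMval, hYT]
    have h1 : 1 ≤ rsFhatSlope b (bwdSLERe κ w T ω * L⁻¹) := one_le_rsFhatSlope hb _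
    have h2 : (w.im * D / L) ^ a ≤ (w.im / L * ‖deriv (fun w' ↦ bwdFlow (sleDriving κ ω) w' T) w‖) ^ a := by
      refine Real.rpow_le_rpow (by positivity) ?_ ha
      rw [mul_div_right_comm]
      exact mul_le_mul_of_nonneg_left hDle (by positivity)
    have h3 : 0 ≤ (L / w.im) ^ lam := (Real.rpow_pos_of_pos (by positivity) _).le
    calc c = 1 * ((w.im * D / L) ^ a * (L / w.im) ^ lam) := by rw [hcdef, one_mul]
      _ ≤ rsFhatSlope b (bwdSLERe κ w T ω * L⁻¹) *
          ((w.im / L * ‖deriv (fun w' ↦ bwdFlow (sleDriving κ ω) w' T) w‖) ^ a * (L / w.im) ^ lam) :=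
        mul_le_mul h1 (mul_le_mul_of_nonneg_right h2 h3) (by positivity) (by positivity)
  -- Chebyshev
  have hmeas : AEMeasurable (fun ω ↦ ENNReal.ofReal (M ω)) preWienerMeasure :=
    (measurable_stoppedProcess_bwdSLEObs hw hTst t).ennreal_ofReal.aemeasurable
  have hcheb := meas_ge_le_lintegral_div hmeas (ε := ENNReal.ofReal c)
    (by simpa using hcpos) ENNReal.ofReal_ne_top
  have hsup := lintegral_stoppedProcess_bwdSLEObs_le (b := b) hw hTst t (κ := κ) (w := w)
  calc preWienerMeasure {ω | bwdSLEImHit κ w L ω ≤ t ∧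
        ∃ T : ℝ≥0, bwdSLEImHit κ w L ω = T ∧ D ≤ ‖deriv (fun w' ↦ bwdFlow (sleDriving κ ω) w' T) w‖}
      ≤ preWienerMeasure {ω | ENNReal.ofReal c ≤ ENNReal.ofReal (M ω)} := measure_mono hsub
    _ ≤ (∫⁻ ω, ENNReal.ofReal (M ω) ∂preWienerMeasure) / ENNReal.ofReal c := hcheb
    _ ≤ ENNReal.ofReal (rsFhatSlope b (w.re * (w.im)⁻¹)) / ENNReal.ofReal c := by gcongr
    _ = ENNReal.ofReal (rsFhatSlope b (w.re * (w.im)⁻¹) / c) := (ENNReal.ofReal_div_of_pos hcpos).symm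
    _ = ENNReal.ofReal (rsFhatSlope b (w.re * (w.im)⁻¹) * (L / (w.im * D)) ^ a * (w.im / L) ^ lam) := by
        congr 1
        rw [hcdef, div_eq_mul_inv, mul_inv, ← Real.rpow_neg (by positivity), ← Real.rpow_neg (by positivity),
          mul_assoc]
        congr 1
        rw [Real.rpow_neg (by positivity), Real.rpow_neg (by positivity), ← Real.inv_rpow (by positivity),
          ← Real.inv_rpow (by positivity), inv_div, inv_div]

end Hitting


end Literature.Probability.RandomPlanarGeometry
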